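import Mathlib
import HarnessLib
import HarnessLib.Audit
import Summits.BirchSwinnertonDyer.Statement
import HarnessLib.Audit.Check
import HarnessLib.Audit.Status.Attr
-- import Summits.BirchSwinnertonDyer.BirchSwinnertonDyer.Theorems.PlecticLegsAssembly dropped: it (transitively) imports this route file — proofs used by `closes`/`_holds` must live in a module that does not import the Theses file

/-!
Route: PlecticLegs

DORMANT since 2026-08-29T21:01:06Z (census g0: costume (trib-confirmed census-trib-costume-A 2026-08-29; 21-frontier 19:16:23Z (b)); reversible --off) — unstaffed, not closed; items shared with open routes are served there. `ledger route dormant <id> --off` reactivates.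

# Route PlecticLegs — excess rank over ℚ is minimal plectic rank over a degree-r totally real field;
Kato descent closes it

PROGRAM-EMBEDDING (lens 3.13, declared here as 3.14 program-completion because the embedding is
printed motivation: NekovarScholl2016, DarmonFornea2025 pp. 2–3, ForneaGehrmann2023 Rem. 1.1). Host
field F = plectic arithmetic of Hilbert/quaternionic Shimura d-folds over totally real fields;
structural conjecture C = the PLECTIC BSD PRINCIPLE: for an elliptic curve V over a totally real
field F with ord_{s=1} L(V/F,s) = [F:ℚ] (the plectic regime: the [F:ℚ]-th derivative is a first
derivative in each of [F:ℚ] plectic directions) one has rank V(F) = [F:ℚ] — LB by plectic Heegner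
points (Nekovář–Scholl, Fornea Conj. 6.10), UB by rank-[F:ℚ] Euler/Kolyvagin systems in core rank
[F:ℚ] (Mazur–Rubin, Burns–Sakamoto–Sano). It suffices to show X = PlecticPointsLB ∧ PlecticRankUB ∧
TwistSupply: C₀ = C in degrees d ≥ 2, plus the analytic supply, for every E/ℚ with r = r_an(E) ≥ 2,
of a totally real abelian F ⊂ ℚ(ζ_m) of degree r all of whose non-trivial twists L(E,χ,1) are ≠ 0.
The implication X ⇒ BSD is PROVED (glue `closes`, 0 sorries) through three known theorems filed as
support — Artin formalism for abelian base change (ArtinBaseChange), Kato Astérisque 295 Cor.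
14.3(2) + Galois-descent rank algebra (KatoDescent), the known cases r_an ≤ 1 (RankLeOne: GZK/Kato)
— modularity (BCDT) entering only their proofs. REV 1 (cone repair 2026-08-17): every item is now
typed over Mathlib + the Statement's own vocabulary (`WeierstrassCurve.LFunction`, `analyticRank`,
`mordellWeilRank`, `CyclotomicField`, `IntermediateField.fixedField`, `DirichletCharacter`,
`LSeries`); the twisted L-value L(E,χ,1) is the value at 1 of the entire continuation of Σ
χ(n)·aₙ(E)·n⁻ˢ (aₙ(E) = `W.LFunction n`), and 'χ trivial on H' is spelled on the m-th roots of unity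
(σ z = z^a ⇒ χ(a) = 1); the imports `Literature.NumberTheory.EllipticCurves.KatoTwistedFiniteness`
(→ CuspFormLFunction: exists_isNewformOf, existsUnique_isNewformOf,
kato_finite_chiPart_of_twistedLValue_ne_zero, all unproved) and
`Literature.NumberTheory.DiophantineGeometry.Conductor` are dropped, so the module cone carries no
unproved named fact beyond the Statement's own `WeierstrassCurve.hasEntireLFunction_rat`. Cards
realised at every degree d: core-rank-two-real-quadratic (UB, d = 2),
plectic-archimedean-heegner-q-curves (LB, d = 2), two-archimedean-legs-biresolvent-gz (the plectic
GZ side).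
Lean: `∀ (F : Type) [Field F] [NumberField F] [NumberField.IsTotallyReal F] (V : WeierstrassCurve F)
[V.IsElliptic], 2 ≤ Module.finrank ℚ F → V.analyticRank = Module.finrank ℚ F → Module.finrank ℚ F ≤
V.mordellWeilRank ∧ (∀ (F : Type) [Field F] [NumberField F] [NumberField.IsTotallyReal F] (V :
WeierstrassCurve F) [V.IsElliptic], 2 ≤ Module.finrank ℚ F → V.analyticRank = Module.finrank ℚ F →
V.mordellWeilRank ≤ Module.finrank ℚ F) ∧ (∀ (W : WeierstrassCurve ℚ) [W.IsElliptic], 2 ≤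
W.analyticRank → ∃ (m : ℕ) (_ : NeZero m), ∃ H : Subgroup (CyclotomicField m ℚ ≃ₐ[ℚ] CyclotomicField
m ℚ), NumberField.IsTotallyReal ↥(IntermediateField.fixedField H) ∧ Module.finrank ℚ
↥(IntermediateField.fixedField H) = W.analyticRank ∧ ∀ χ : DirichletCharacter ℂ m, (∀ σ ∈ H, ∀ a :
ℕ, (∀ z : CyclotomicField m ℚ, z ^ m = 1 → σ z = z ^ a) → χ (a : ZMod m) = 1) → χ ≠ 1 → ∃ L : ℂ → ℂ,
Differentiable ℂ L ∧ (∀ s : ℂ, 2 < s.re → L s = LSeries (fun n ↦ χ n * ((W.LFunction n : ℤ) : ℂ)) s)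
∧ L 1 ≠ 0)`

## Assembly
Proved in glue.lean (`closes`, rev 1, lean check rc 0, 0 sorries, axioms standard): given E/ℚ
elliptic, if r_an ≤ 1 use RankLeOne; else TwistSupply gives (m, H) with F = ℚ(ζ_m)^H totally real of
degree r = r_an(E) and every non-trivial twist L(E,χ,1), χ a character of Gal(F/ℚ), non-vanishing;
ArtinBaseChange gives r_an(E_F) = r = [F:ℚ]; PlecticPointsLB and PlecticRankUB at (F, E_F) give rank
E(F) = [F:ℚ]; KatoDescent gives rank E(ℚ) = rank E(F) = r. Pure logic over the six items (omega
closes the arithmetic); no newform, conductor or χ-part vocabulary is needed at glue level.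

Rationale: WHY THIS LINE. The one proved engine for BSD (Gross–Zagier–Kolyvagin, d = 1) works because analytic
rank 1 is the MINIMAL order forced in its setting; every ℚ-based route on the board (SelmerRank,
Squeeze, HigherGrossZagier, PAdicOrderV2, ShadowIsolation, LeadingTerm, ToricShedding, FrozenTwin)
keeps the field ℚ, where an accidental zero of order r ≥ 2 is invisible to Heegner points (torsion),
to core-rank-1 Euler systems (Kato stops one dimension short) and to signs (parity). Over a totally
real F of degree r = r_an(E) with all non-trivial twists non-vanishing (a "silent" field: L(E_F,s) =
∏_χ L(E,χ,s) has order exactly r and, by Kato2004Asterisque Cor. 14.3(2), rank E(F) = rank E(ℚ)),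
the same zero becomes the minimal plectic order [F:ℚ] — the configuration for which Nekovář–Scholl's
plectic conjecture predicts CM zero-cycles on quaternionic Shimura r-folds X_B/F to carry a class in
∧^r of Selmer (NekovarScholl2016; ForneaGehrmann2023 §1.1; arXiv:2305.01130 §6.1 Conj. 6.8–6.10;
DarmonFornea2025 Conj. 3.9–3.10) and for which the Mazur–Rubin core rank of T_pE over F equals r =
#real places, so a rank-r Kolyvagin system bounds the Selmer corank by r with NO comparison of
orders of vanishing (MazurRubin2017 Prop. 28 and main theorem; arXiv:1612.06187). Imported areas:
plectic/Hodge-theoretic structure of Res_{F/ℚ} Shimura varieties and multi-leg (Yun–Zhang,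
YunZhang2017) geometry transposed to number fields; higher-rank Euler-system algebra; analytic
theory of twisted central values (FriedbergHoffstein1995, FearnleyKisilevskyKuwata2012, Rohrlich
1984) for the field supply, which is certified EXACTLY by modular symbols. What no prior route does:
change the base field so that the excess rank is load-bearing for an existing programme, with the
reduction BSD ⇐ (plectic-regime BSD over F) + (twist supply) kernel-checked; calibration: d = 1 of C
is GZK, and DarmonFornea2025 Thm. 3.7–3.8 re-derive "L(E/K,1) ≠ 0 ⇒ E'(ℚ) finite" from a (mock)
plectic invariant, ForneaGehrmann2023 Thm. A proves the r-th-derivative leading-term formula on the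
p-adic side.

RANKED CRUXES. #2 PlecticPointsLB (crux) — PLECTIC POINTS (lower bound of C): for every totally real
number field F of degree d ≥ 2 and every elliptic curve V/F whose L-function vanishes to order
exactly d at s = 1, rank_ℤ V(F) ≥ d — the output of a non-torsion plectic Heegner point in ∧^d V(F)
(Nekovář–Scholl; Fornea Conj. 6.10 '⇐'; FG Conj. 1.5) or of d independent plectic Selmer classes
plus Ш-cotorsion in the plectic regime (birth stubs selmerLB_F, pointsOfSelmer_F). [difficulty:
open-problem] (why it might fail: for base-change curves E_F the plectic class is forced into a
sign-eigenspace and 'can vanish for trivial reasons' (DarmonFornea2025 §3.8; FG Conj 1.5 primitivity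
clause; EZ-BC card): the statement stays true but the only engine may not see the configuration
BSD/ℚ needs.) [NekovarScholl2016, arXiv:2305.01130, ForneaGehrmann2023, ForneaGuitartMasdeu2022,
DarmonFornea2025, YunZhang2017]
#3 PlecticRankUB (crux) — CORE RANK d (upper bound of C): same F, V, hypotheses ⇒ rank_ℤ V(F) ≤ d —
the output of a rank-d Kolyvagin/Stark system for T_pV over F (core rank χ(T_pV/F) = #real places =
d, Mazur–Rubin 2016 Prop. 28) with non-zero leading class, which makes the dual Selmer group finite
and caps corank Sel_{p^∞}(V/F) by d (birth stubs selmerUB_F, kummer_F); candidates for the system: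
plectic Siegel-unit classes (Nekovář–Scholl), Perrin-Riou's conjectural rank-d systems. [difficulty:
open-problem] (why it might fail: no Euler system of rank ≥ 2 for a GL₂-type motive is known
(Asai–Flach classes have rank one and see L(As), not L(E_F)); the rank-d reciprocity law tying the
leading class to L^{(d)}(V/F,1) hides the regulator comparison (MR 2016 p.3: 'for r > 1 the
connection to L-values is still mysterious').) [MazurRubin2017, arXiv:1612.06187, arXiv:1805.08448,
NekovarScholl2016, Kato2004Asterisque]
#4 TwistSupply (crux) — SILENT FIELD SUPPLY (analytic number theory; rev 1: stated on the curve's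
own twisted Dirichlet series, no newform): for every elliptic E/ℚ with r = r_an(E) ≥ 2 there are m ≥
1 and a subgroup H of Gal(ℚ(ζ_m)/ℚ) whose fixed field F is totally real of degree r such that every
non-trivial Dirichlet character χ mod m trivial on H (σ ∈ H acts on μ_m by z ↦ z^a ⇒ χ(a) = 1, i.e.
χ is a character of Gal(F/ℚ)) has L(E,χ,1) ≠ 0: the entire continuation of Σ χ(n)aₙ(E)n⁻ˢ (aₙ(E) =
Mathlib `WeierstrassCurve.LFunction`; the missing Euler polynomials at p | m do not vanish at s = 1,
|α_p| = √p, so imprimitivity is harmless) is non-zero at s = 1. Known for r = 2 (one even quadratic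
twist: FriedbergHoffstein1995 Thm B; in tree modulo hasEntireLFunction_rat via
`HoffsteinLuo1997_exists_twist_L_one_ne_zero` with S = N.primeFactors, parity of the root number,
and `LFunction_quadraticTwist_apply_of_emod_four_eq_one` — grounder note 2026-08-17); for cyclic F
of prime degree ℓ one non-vanishing χ of order ℓ suffices (Galois-conjugate algebraic parts,
Shimura; FKK §1). [difficulty: L] (why it might fail: open for r ≥ 3 when L(E,1) = 0: FKK2012 Thm
1.1 needs L(E,1) ≠ 0 (no main term in the first moment otherwise); Rohrlich 1984 controls ℓ-power
towers only cofinitely; false only if every totally real abelian degree-r F has a vanishing twist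
(against DFK heuristics).) [FriedbergHoffstein1995, BumpFriedbergHoffstein1990, MurtyMurty1991,
HoffsteinLuo1997, FearnleyKisilevskyKuwata2012, RohrlichInventiones1984, arXiv:0711.1771]
#9 ArtinBaseChange (support) — Artin formalism for abelian base change (known; rev 1: curve-side
twisted series, no newform): for E/ℚ elliptic, m ≥ 1 and H ≤ Gal(ℚ(ζ_m)/ℚ) with fixed field F, if
every non-trivial χ mod m trivial on H has its twisted series' entire continuation non-zero at 1,
then r_an(E_F) = r_an(E) (`(W.baseChange F).analyticRank = W.analyticRank`): L(E_F,s) = ∏_{χ ∈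
Gal(F/ℚ)^} L(V_ℓE ⊗ χ, s) (Mathlib's `LFunction` of E_F is the Euler product over the primes of 𝓞_F
of local factors of minimal models), each factor entire (BCDT + twisting) and equal to the naive
twisted series up to finitely many Euler polynomials at p | m, non-vanishing at 1; degree-1 case F ≅
ℚ by transport along the isomorphism. The quadratic case is the tree theorem
`WeierstrassCurve.analyticRankOver_eq_add_of_hasEntireLFunction_rat`
(AnalyticRankOverNumberFieldProofs) with `analyticRank_eq_zero_iff_holds` for the twist. Proof-level
dependence (not in the cone): modularity (`exists_isNewformOf` / `hasEntireLFunction_rat`).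
[difficulty: L–XL] [Darmon2004, IrelandRosen1990, DiamondShurman2005, BCDTJAMS2001]
#9 KatoDescent (support) — Kato descent (known; rev 1 merges rev-0 KatoChiFinite + RankDescent and
drops the newform/χ-part vocabulary): same E, m, H, F and the same non-vanishing hypothesis ⇒ rank_ℤ
E(F) = rank_ℤ E(ℚ) (`(W.baseChange F).mordellWeilRank = W.mordellWeilRank`): (≥) E(ℚ) ↪ E(F)
(`Point.map_injective`, Mordell–Weil `module_finite_point_holds`; cf.
`mordellWeilRank_baseChange_le_of_algHom`); (≤) E(F) ⊗ ℚ splits into isotypic parts over the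
ℚ-rational characters of G = Gal(F/ℚ); for χ ≠ 1, Kato2004Asterisque Cor. 14.3 (2) (E modular ⇒
quotient of J₁(N); K = F finite abelian; Kato's L_S(f,χ,1), S = prime(cond F), differs from the
mod-m series only by Euler polynomials non-vanishing at 1) makes E(F)^{(χ)} = {x : I_χ·x = 0}
finite, so the χ-eigenspace of E(F) ⊗ ℂ is 0; the trivial part is E(F)^G ⊗ ℚ = E(ℚ) ⊗ ℚ. The printed
input is the vendored named fact
`Literature.NumberTheory.EllipticCurves.kato_finite_chiPart_of_twistedLValue_ne_zero`
(KatoTwistedFiniteness.lean, K = ℚ(ζ_m)), deliberately NOT imported (unproved, XL): proof-level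
dependence only. [difficulty: XL] [Kato2004Asterisque, RubinEulerSystems2000, SilvermanAEC2009]
#9 RankLeOne (support) — the known cases (calibration, d ≤ 1 of the plectic principle): r_an(E) ≤ 1
⇒ r_an(E) = rank E(ℚ) (Gross–Zagier 1986 + Kolyvagin 1990 with a non-vanishing quadratic twist; Kato
2004 for r_an = 0). [difficulty: XL] [GrossZagierInvent1986, KolyvaginEulerSystems1990,
Kato2004Asterisque, BumpFriedbergHoffstein1990, MurtyMurty1991]

TWO-LAYER PLAN. Foreseen glued splits (depth 1, filed only when a crux moves): PlecticPointsLB ⇐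
SelmerLB_F (plectic global classes: corank Sel_{p^∞}(V/F) ≥ d at every p) → PointsOfSelmer_F (no
divisible Ш at every prime in the plectic regime) → PlecticPointsLB (birth skeleton
bc/PlecticPointsLB_birth.lean); PlecticRankUB ⇐ SelmerUB_F (∃ p, corank ≤ d: core-rank-d system) →
Kummer_F (rank ≤ corank over F, known) → PlecticRankUB; TwistSupply ⇐ (r = 2: Friedberg–Hoffstein) →
(r ≥ 3: simultaneous non-vanishing) → TwistSupply.

KILL CRITERIA. Refuted outright: a curve V over a totally real F with r_an(V/F) = [F:ℚ] ≥ 2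
certified and rank ≠ [F:ℚ] (refutes BSD over F; close refuted:PlecticPointsLB or :PlecticRankUB).
Pivot: if the plectic classes of BASE-CHANGE curves are shown to vanish identically (EZ-BC proved,
or FGM-type computation + a structural reason covering the motivic class, not only its p-adic
localisation), the cruxes stay but lose their engine for the configuration BSD/ℚ needs — pivot to
Darmon–Fornea's twist trick (concentrated rank in the minus eigenspace via a non-split
multiplicative prime) or retire as costume. TwistSupply refuted for one E (no silent field of degree
r_an(E) at all) would be a discovery about twisted central values; the route would then need
non-abelian silent fields (no Kato) and closes. Mooted if SelmerRank or PAdicOrderV2 closes BSD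
first.

NOT DECOMPOSED YET. The plectic objects themselves (plectic cohomology of X_B, plectic Abel–Jacobi,
CM 0-cycles, core-rank-d Kolyvagin systems) are not typed: the cruxes are stated by their OUTPUT
over F (rank bounds in the plectic regime), and the Selmer-level children (Two-layer plan) wait for
a first movement; the CM field K/F, the quaternion algebra B and the auxiliary non-vanishing L(E_F ⊗
η_K,1) ≠ 0 (Friedberg–Hoffstein over F) live inside the proof of crux #2, not as items; no constant
or threshold is fixed. Items after rev 1 (cone repair 2026-08-17): 7 (3 cruxes, 3 supports, 1
assembly; rev 0: 9 — Modularity and KatoChiFinite dropped as items, now proof-level inside the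
supports); module import cone after rev 1: Mathlib + HarnessLib + the Statement only (rev 0: +
KatoTwistedFiniteness → CuspFormLFunction, Conductor), 1 unproved named fact
(hasEntireLFunction_rat, via the Statement).

CHEAPEST FALSIFIER. (a) TwistSupply at the first rank-3 curve: E = 5077a1 (r_an = 3 exactly,
BuhlerGrossZagier1985): find ONE even cubic Dirichlet character χ (conductor p ≡ 1 mod 6, F = cubic
subfield of ℚ(ζ_p), totally real) with L(E,χ,1) ≠ 0, certified EXACTLY by modular symbols (algebraic
part in ℤ[ζ_3]) — a kit/PARI job of minutes; I could not run it this cycle (no local compute on the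
hub; not yet submitted). (b) The EZ-BC experiment of card base-change-extra-zero-receptacles
(Masdeu's plectic-invariant code on one rank-2 base-change example) tests whether FG's p-adic
plectic invariants see ℚ-curves at all. (c) Lookup done: no printed curve over a totally real F with
r_an = [F:ℚ] and rank ≠ [F:ℚ] (would contradict BSD/F); LMFDB ecnf agrees on real quadratic fields
wherever both are computed.

NUMBERS. r_an(5077a1) = 3 (BuhlerGrossZagier1985); smallest conductor of rank 2 over ℚ: 389; DFK
prediction: N_E(n,X) bounded for φ(n) ≥ 6, ~X^{1/2} log^a X for φ(n) = 2
(FearnleyKisilevskyKuwata2012 §1); core rank χ(T_pE/F) = [F:ℚ] for F totally real (MazurRubin2017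
Prop. 28).

DEFINITION REQUESTS. None needed to state the items (rev 1: all over Mathlib + the Statement's
AnalyticRank / MordellWeil vocabulary — `WeierstrassCurve.LFunction`, `LSeries`,
`DirichletCharacter`, `CyclotomicField`, `IntermediateField.fixedField`,
`NumberField.IsTotallyReal`, `analyticRank`, `mordellWeilRank`;
`Literature.NumberTheory.EllipticCurves.KatoTwistedFiniteness` (chiPart, cyclotomicCharacterOf, the
Kato fact) and, through it, `CuspFormLFunction` (IsNewformOf, twistedLSeries, and the unproved
modularity facts exists_isNewformOf / existsUnique_isNewformOf, XL) are deliberately NOT imported —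
precedent ShadowIsolation rev 3, HeptagonalTower 2026-08-17; the rev-0 and rev-1 typings of
TwistSupply are equivalent by IsNewformOf (aₙ(f) = aₙ(E)) and the non-vanishing at s = 1 of the
Euler polynomials at p | m). CONE DEBT, genuinely needed and not re-routable — needs-fact:
WeierstrassCurve.hasEntireLFunction_rat (Literature/NumberTheory/EllipticCurves/AnalyticRank.lean;
it enters through Summits/BirchSwinnertonDyer/BirchSwinnertonDyer/Statement.lean itself —
analyticRank := analyticOrderNatAt entireLFunction 1 is a junk value without it — so it lies in the
cone of every route of the summit; in tree it is modularity:
hasEntireLFunction_rat_of_exists_isNewformOf, AnalyticRankModularityProofs). Proof-level (not cone)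
dependences provers should expect: TwistSupply and ArtinBaseChange on exists_isNewformOf /
hasEntireLFunction_rat (continuation of the twisted series), KatoDescent on
kato_finite_chiPart_of_twistedLValue_ne_zero (Kato Cor. 14.3(2)). Wanted later, for the layer-2
children and the engine: `Literature/NumberTheory/EulerSystems` — `coreRank`, `KolyvaginSystemOfRank
r` (after Mazur–Rubin / Burns–Sakamoto–Sano); `Literature/AlgebraicGeometry/ShimuraVarieties` —
quaternionic Hilbert modular varieties X_B/F and CM zero-cycles; a cite fact for Friedberg–Hoffstein
1995 Thm B over ℚ AND over totally real F (the tree has Hoffstein–Luo 1997 over ℚ: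
`HoffsteinLuo1997_exists_twist_L_one_ne_zero`); Rohrlich 1984 is in tree as
`Rohrlich1984_nonvanishing_twists` (RohrlichNonvanishing.lean, newform-side, imports
CuspFormLFunction — use at proof level only).

Novelty: Searches (2026-08-17): `lit search "plectic" --source zbmath` (15; NekovarScholl2016,
DarmonFornea2025 'Mock plectic points', Marquis 2024 multivariable plectic Lubin–Tate), `--source
crossref "plectic Stark-Heegner"` (9; ForneaGehrmann2023), `lit search --hybrid "plectic"` (0
relevant held), `lit read arXiv:2310.16758` (DF, read pp. 1–4, 10, 14), `lit read arXiv:2104.12575`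
pp. 1–4 (FG §1.1, Rem 1.1), `lit read arXiv:0711.1771` pp. 1–4 (FKK Thms 1.1–1.3), payload
embedding_lit.json (18 textbook hits, none an embedding), bridges.json (80 rows,
modularity/Langlands surveys), `lean search` for plectic/fixedField/IsTotallyReal statements in
Summits (hits: barrier files, crux-idea `plectic-twist-to-rank-zero` on LeadingTerm.Consistency, d =
2), hub cards read: core-rank-two-real-quadratic, plectic-archimedean-heegner-q-curves,
base-change-extra-zero-receptacles, two-archimedean-legs-biresolvent-gz,
constant-receptacle-motivicity; OpenAlex/S2/arXiv APIs rate-limited (429) this session.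
Nearest prior art found: NekovarScholl2016 / DarmonFornea2025 pp. 2–3 (plectic Heegner points ↔
regulators of rank-two curves over real quadratic fields; mock version for rank-two curves over ℚ,
Conj. 3.9–3.10 with the base-change degeneracy remark §3.8); ForneaGehrmann2023 §1.1 + Rem 1.1 (the
'long-standing open problem' P ∈ ∧^r A(E), p-adic localisation blind for ℚ-curves); hub cards
core-rank-two-real-quadratic (graded variant: 'r real places for accidental rank r') and
plectic-archimedean-heegne  [refs: 2310.16758, 2104.12575, 0711.1771, NekovarScholl2016, DarmonFornea2025, ForneaGehrmann2023]

Barriers (technique_class: plectic-points, core-rank-euler-systems, base-change): - technique_class: plectic-points, core-rank-euler-systems, base-change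
- Literature.Barriers.BirchSwinnertonDyer.HeegnerPointBarrier: evaded by construction — no Heegner
or CM point on a Shimura CURVE is used at d ≥ 2; the objects are CM zero-cycles on quaternionic
d-folds whose classical Abel–Jacobi image is trivial (FG obstacle (ii)) and whose plectic refinement
is the new input; the barrier's theorem (y_K torsion for r_an ≥ 2) is exactly why the field is
changed.
- Literature.Barriers.BirchSwinnertonDyer.SelmerRankBarrier: applies to the Selmer-level children
(plectic CLASSES are not points): conceded and isolated as the foreseen child PointsOfSelmer_F ('no
divisible Ш at every prime in the plectic regime'); evaded by the archimedean plectic points of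
arXiv:2305.01130 §6 (ℤ-bilinear receptacle E⊗H₁(E,ℤ), points not classes) if those are the engine.
- Literature.Barriers.BirchSwinnertonDyer.FunctionalEquationSeesOnlyParity: not a sign argument —
the input is r_an(V/F) = [F:ℚ] exactly and a constructed class/point; parity is used nowhere.
- Literature.Barriers.BirchSwinnertonDyer.PAdicFunctionalEquationSeesOnlyParity: same; no Λ-adic
sign enters.
- Literature.Barriers.BirchSwinnertonDyer.ExceptionalZeroBarrier: touches only FG's p-adic
realisation at multiplicative primes (their setting p_S ∥ 𝔣_A); the cruxes are stated over F without
p, and the motivic/archimedean plectic classes do not pass through a p-adic L-function's order of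
vanishing.
- Literature.Barriers.BirchSwinn

History (route lifecycle, newest last):
- 2026-08-17T02:24:37Z · rev 1: restated TwistSupply (stmt-BirchSwinnertonDyer-17520), ArtinBaseChange (stmt-BirchSwinnertonDyer-17523), RankDescent (stmt-BirchSwinnertonDyer-17524), Assembly (stmt-BirchSwinnertonDyer-17526) — cone repair (route-repair seat, repair_kind=cone): imports KatoTwistedFiniteness (→ CuspFormLFunction: exists_isNewfor (planner-rrepair-BirchSwinnertonDyer-PlecticLeg-8fe3cac2-0)
- 2026-08-17T02:24:37Z · rev 1: dropped Modularity, KatoChiFinite — cone repair (route-repair seat, repair_kind=cone): imports KatoTwistedFiniteness (→ CuspFormLFunction: exists_isNewformOf, existsUnique_isNewformOf, kato_finite (planner-rrepair-BirchSwinnertonDyer-PlecticLeg-8fe3cac2-0)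
- 2026-08-24T14:36:05Z · DORMANT — reconciler: no traction for 6.8 d (last activity item-evidence-added at 2026-08-17T18:04:49Z); parked, not closed — `ledger route dormant route-BirchSwinnertonD (operator:999:1388563)
- 2026-08-29T01:44:27Z · REACTIVATED — reconciler: reactivated — activity statement-checked at 2026-08-28T23:45:41Z after parking at 2026-08-24T14:36:05Z (operator:999:1208261)
- 2026-08-29T21:01:06Z · DORMANT — census g0: costume (trib-confirmed census-trib-costume-A 2026-08-29; 21-frontier 19:16:23Z (b)); reversible --off (operator:999:1694988)

sub-problem: BirchSwinnertonDyer · status: dormant · opened planner-plan-lens3-BirchSwinnertonDyer-embed-0 2026-08-17T02:00:31Z · rev 1 · ledger route-BirchSwinnertonDyer-PlecticLegs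
GENERATED by the gate from the ledger (D-0016/17). Provers cite these decls: `theorem foo : Summit.BirchSwinnertonDyer.BirchSwinnertonDyer.Theses.PlecticLegs.<Decl> := …` in Summits/BirchSwinnertonDyer/BirchSwinnertonDyer/Theorems/<Name>.lean.
-/

namespace Summit.BirchSwinnertonDyer.BirchSwinnertonDyer.Theses.PlecticLegs

open scoped BigOperators Topology Manifold Classical MeasureTheory ProbabilityTheory Matrix InnerProductSpace ComplexConjugate ContinuousMap
open Filter Set Function TopologicalSpace MeasureTheory

attribute [summit_statement] _root_.BirchSwinnertonDyer

open Literature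

/-- item stmt-BirchSwinnertonDyer-17518 · crux · rank 2 · open · by planner
why it might fail: for base-change curves E_F the plectic class is forced into a sign-eigenspace and 'can vanish for trivial reasons' (DarmonFornea2025 §3.8; FG Conj 1.5 primitivity clause; EZ-BC card): the statement stays true but the only engine may not see the configuration BSD/ℚ needs.
sources: NekovarScholl2016, arXiv:2305.01130, ForneaGehrmann2023, ForneaGuitartMasdeu2022, DarmonFornea2025, YunZhang2017
[crux] PLECTIC POINTS (lower bound of C): for every totally real number field F of degree d ≥ 2 and
every elliptic curve V/F whose L-function vanishes to order exactly d at s = 1, rank_ℤ V(F) ≥ d —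
the output of a non-torsion plectic Heegner point in ∧^d V(F) (Nekovář–Scholl; Fornea Conj. 6.10
'⇐'; FG Conj. 1.5) or of d independent plectic Selmer classes plus Ш-cotorsion in the plectic regime
(birth stubs selmerLB_F, pointsOfSelmer_F). [difficulty: open-problem] -/
@[route_item "route-BirchSwinnertonDyer-PlecticLegs", crux]
def PlecticPointsLB : Prop :=
  ∀ (F : Type) [Field F] [NumberField F] [NumberField.IsTotallyReal F] (V : WeierstrassCurve F) [V.IsElliptic], 2 ≤ Module.finrank ℚ F → V.analyticRank = Module.finrank ℚ F → Module.finrank ℚ F ≤ V.mordellWeilRank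

/-- item stmt-BirchSwinnertonDyer-17519 · crux · rank 3 · open · by planner
why it might fail: no Euler system of rank ≥ 2 for a GL₂-type motive is known (Asai–Flach classes have rank one and see L(As), not L(E_F)); the rank-d reciprocity law tying the leading class to L^{(d)}(V/F,1) hides the regulator comparison (MR 2016 p.3: 'for r > 1 the connection to L-values is still mysterious').
sources: MazurRubin2017, arXiv:1612.06187, arXiv:1805.08448, NekovarScholl2016, Kato2004Asterisque
[crux] CORE RANK d (upper bound of C): same F, V, hypotheses ⇒ rank_ℤ V(F) ≤ d — the output of a
rank-d Kolyvagin/Stark system for T_pV over F (core rank χ(T_pV/F) = #real places = d, Mazur–Rubin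
2016 Prop. 28) with non-zero leading class, which makes the dual Selmer group finite and caps corank
Sel_{p^∞}(V/F) by d (birth stubs selmerUB_F, kummer_F); candidates for the system: plectic
Siegel-unit classes (Nekovář–Scholl), Perrin-Riou's conjectural rank-d systems. [difficulty:
open-problem] -/
@[route_item "route-BirchSwinnertonDyer-PlecticLegs", crux]
def PlecticRankUB : Prop :=
  ∀ (F : Type) [Field F] [NumberField F] [NumberField.IsTotallyReal F] (V : WeierstrassCurve F) [V.IsElliptic], 2 ≤ Module.finrank ℚ F → V.analyticRank = Module.finrank ℚ F → V.mordellWeilRank ≤ Module.finrank ℚ F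

-- earlier TwistSupply (stmt-BirchSwinnertonDyer-17520, replaced 2026-08-17T02:24:37Z -> stmt-BirchSwinnertonDyer-18260): retired by None — ∀ (W : WeierstrassCurve ℚ) [W.IsElliptic] {N : ℕ} [NeZero N] (f : CuspForm (CongruenceSubgroup.Gamma0 N) 2), Literature.NumberTheory.EllipticCurves.ModularForms.IsNewformOf W f → 2 ≤ W.analyticRank → ∃ (m : ℕ) (_ : NeZero m), m % 4 ≠ 2 ∧ ∃ H : Subgroup (Cyclotomi
/-- item stmt-BirchSwinnertonDyer-18260 · crux · rank 4 · open · by planner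
why it might fail: open for r ≥ 3 when L(E,1) = 0: FKK2012 Thm 1.1 needs L(E,1) ≠ 0 (no main term in the first moment otherwise); Rohrlich 1984 controls ℓ-power towers only cofinitely; false only if every totally real abelian degree-r F has a vanishing twist (against DFK heuristics).
sources: FriedbergHoffstein1995, BumpFriedbergHoffstein1990, MurtyMurty1991, HoffsteinLuo1997, FearnleyKisilevskyKuwata2012, RohrlichInventiones1984
[crux] SILENT FIELD SUPPLY (analytic number theory; REROUTED 2026-08-17, cone repair — stated on the
curve's own twisted Dirichlet series, no newform f, no IsNewformOf): for every elliptic E/ℚ with r =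
r_an(E) ≥ 2 there are m ≥ 1 and a subgroup H of Gal(ℚ(ζ_m)/ℚ) whose fixed field F is totally real of
degree r such that every non-trivial Dirichlet character χ mod m trivial on H (σ ∈ H acts on the
m-th roots of unity by z ↦ z^a ⇒ χ(a) = 1, i.e. χ is a character of Gal(F/ℚ)) has L(E,χ,1) ≠ 0: the
entire continuation of Σ χ(n)·aₙ(E)·n⁻ˢ (aₙ(E) = Mathlib `WeierstrassCurve.LFunction`, the
Hasse–Weil coefficients; agreement asked on Re s > 2 as in KatoTwistedFiniteness / HeptagonalTower;
continuation by modularity, unique by the identity theorem) is non-zero at s = 1. Equivalent to the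
rev-0 newform phrasing by IsNewformOf (aₙ(f) = aₙ(E)); the Euler polynomials missing at p | m do not
vanish at s = 1 (|α_p| = √p), so imprimitivity is harmless and m ≢ 2 (mod 4) is no longer required.
Known for r = 2 (one even quadratic twist with L(E^{(d)},1) ≠ 0, d > 0: FriedbergHoffstein1995 Thm
B; in tree modulo hasEntireLFunction_rat via HoffsteinLuo1997_exists_twist_L_one_ne_zero with S =
N.primeFact -/
@[route_item "route-BirchSwinnertonDyer-PlecticLegs", crux]
def TwistSupply : Prop :=
  ∀ (W : WeierstrassCurve ℚ) [W.IsElliptic], 2 ≤ W.analyticRank → ∃ (m : ℕ) (_ : NeZero m), ∃ H : Subgroup (CyclotomicField m ℚ ≃ₐ[ℚ] CyclotomicField m ℚ), NumberField.IsTotallyReal ↥(IntermediateField.fixedField H) ∧ Module.finrank ℚ ↥(IntermediateField.fixedField H) = W.analyticRank ∧ ∀ χ : DirichletCharacter ℂ m, (∀ σ ∈ H, ∀ a : ℕ, (∀ z : CyclotomicField m ℚ, z ^ m = 1 → σ z = z ^ a) → χ (a : ZMod m) = 1) → χ ≠ 1 → ∃ L : ℂ → ℂ, Differentiable ℂ L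 ∧ (∀ s : ℂ, 2 < s.re → L s = LSeries (fun n ↦ χ n * ((W.LFunction n : ℤ) : ℂ)) s) ∧ L 1 ≠ 0

-- earlier ArtinBaseChange (stmt-BirchSwinnertonDyer-17523, replaced 2026-08-17T02:24:37Z -> stmt-BirchSwinnertonDyer-18261): retired by None — ∀ (W : WeierstrassCurve ℚ) [W.IsElliptic] {N : ℕ} [NeZero N] (f : CuspForm (CongruenceSubgroup.Gamma0 N) 2), Literature.NumberTheory.EllipticCurves.ModularForms.IsNewformOf W f → ∀ (m : ℕ) [NeZero m] (H : Subgroup (CyclotomicField m ℚ ≃ₐ[ℚ] CyclotomicField m 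
/-- item stmt-BirchSwinnertonDyer-18261 · crux · rank 9 · open · by planner
sources: Darmon2004, IrelandRosen1990, DiamondShurman2005, BCDTJAMS2001
[support] Artin formalism for abelian base change (known; REROUTED 2026-08-17, cone repair —
curve-side twisted series, no newform): for E/ℚ elliptic, m ≥ 1 and H ≤ Gal(ℚ(ζ_m)/ℚ) with fixed
field F: if every non-trivial Dirichlet character χ mod m trivial on H has an entire continuation of
Σ χ(n)aₙ(E)n⁻ˢ non-zero at s = 1, then r_an(E_F) = r_an(E) (`(W.baseChange F).analyticRank =
W.analyticRank`). Chain: L(E_F,s) = ∏_{χ ∈ Gal(F/ℚ)^} L(V_ℓE ⊗ χ, s) (Artin formalism for the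
compatible system; Mathlib's `LFunction` of E_F is the Euler product over the primes of 𝓞_F of the
local factors of minimal models = L(E_F,s)); each factor is entire (BCDT modularity + twisting) and
differs from the naive twisted series by finitely many Euler polynomials at p | m, entire and
non-vanishing at s = 1; so L(E_F,s) is entire and ord_{s=1} L(E_F,s) = ord L(E,s) + Σ_{χ≠1} ord
L(E,χ,s) = r_an(E). Degree-1 case (H = ⊤, F ≅ ℚ): transport of analyticRank along the isomorphism.
The quadratic case is the tree theorem
`WeierstrassCurve.analyticRankOver_eq_add_of_hasEntireLFunction_rat`
(AnalyticRankOverNumberFieldProofs) with `analyticRank_eq_zero_iff_holds` for the twist E^{(d_F)}.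
Proof-level dependence (not -/
@[route_item "route-BirchSwinnertonDyer-PlecticLegs", crux]
def ArtinBaseChange : Prop :=
  ∀ (W : WeierstrassCurve ℚ) [W.IsElliptic] (m : ℕ) [NeZero m] (H : Subgroup (CyclotomicField m ℚ ≃ₐ[ℚ] CyclotomicField m ℚ)), (∀ χ : DirichletCharacter ℂ m, (∀ σ ∈ H, ∀ a : ℕ, (∀ z : CyclotomicField m ℚ, z ^ m = 1 → σ z = z ^ a) → χ (a : ZMod m) = 1) → χ ≠ 1 → ∃ L : ℂ → ℂ, Differentiable ℂ L ∧ (∀ s : ℂ, 2 < s.re → L s = LSeries (fun n ↦ χ n * ((W.LFunction n : ℤ) : ℂ)) s) ∧ L 1 ≠ 0) → (letI : NumberField ↥(IntermediateField.fixedField H) := NumberField.mk; (W.baseChange ↥(IntermediateField.fixedField H)).analyticRank = W.analyticRank)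

/-- item stmt-BirchSwinnertonDyer-17990 · support · rank 5 · open · by planner
[crux] ABELIAN CONTINUATION — PROMOTED apex fact (route-choice seat
rchoice-Summits-BirchSwinnertonDyer-Bi-c3374bfa, 2026-08-17; payload.route_choice on
Theorems/PlecticLegsArtinBaseChange.lean, whose only unproved input
`Literature.NumberTheory.EllipticCurves.hasEntireLFunction_baseChange_fixedField` was judged
XL-apex, not splittable as a non-crux fact): this item IS that fact verbatim (`Iff.rfl`;
SketchCheck.lean rc 0). For every elliptic E/ℚ, every m ≥ 1 and every H ≤ Gal(ℚ(ζ_m)/ℚ) with fixed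
field F = ℚ(ζ_m)^H (all abelian fields, Kronecker–Weber), L(E/F, s) — Mathlib's `LSeries` of
`W.baseChange F`, the Euler product over the primes of 𝓞_F of local-minimal-model factors, abs.
convergent on Re s > 3/2 — extends to an entire function (`HasEntireLFunction`). THEOREM IN PRINT:
modularity (BCDTJAMS2001 Thm A) + entire continuation of L(A_f, τ, s) for one-dimensional τ
(Rohrlich1997 §3.9 Conj. 2, PDF p. 153 of book:cornell1997-modular-forms-fermats-last-theorem: 'If A
= A_f and τ is one-dimensional then Conjecture 2 is subsumed in the results of Carayol',
CarayolASENS1986) + Artin formalism L(E/F,s) = ∏_χ L(E,χ,s) with Carayol/Atkin–Li local factors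
(GetzHahn2024 (12.6)–(12.7); Kah -/
@[route_item "route-BirchSwinnertonDyer-PlecticLegs"]
def BaseChangeContinuation : Prop :=
  ∀ (W : WeierstrassCurve ℚ) [W.IsElliptic] (m : ℕ) [NeZero m] (H : Subgroup (CyclotomicField m ℚ ≃ₐ[ℚ] CyclotomicField m ℚ)), (W.baseChange ↥(IntermediateField.fixedField H)).HasEntireLFunction

/-- item stmt-BirchSwinnertonDyer-17525 · support · rank 9 · open · by planner
sources: GrossZagierInvent1986, KolyvaginEulerSystems1990, Kato2004Asterisque, BumpFriedbergHoffstein1990, MurtyMurty1991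
[support] the known cases (calibration, d ≤ 1 of the plectic principle): r_an(E) ≤ 1 ⇒ r_an(E) =
rank E(ℚ) (Gross–Zagier 1986 + Kolyvagin 1990 with a non-vanishing quadratic twist; Kato 2004 for
r_an = 0). [difficulty: XL] -/
@[route_item "route-BirchSwinnertonDyer-PlecticLegs", crux]
def RankLeOne : Prop :=
  ∀ (W : WeierstrassCurve ℚ) [W.IsElliptic], W.analyticRank ≤ 1 → W.analyticRank = W.mordellWeilRank

/-- item stmt-BirchSwinnertonDyer-18262 · support · rank 9 · open · by planner
sources: Kato2004Asterisque, RubinEulerSystems2000, SilvermanAEC2009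
[support] Kato descent (known; REROUTED 2026-08-17, cone repair — merges rev-0 KatoChiFinite +
RankDescent and drops the newform / χ-part vocabulary): for E/ℚ elliptic, m ≥ 1 and H ≤
Gal(ℚ(ζ_m)/ℚ) with fixed field F: if every non-trivial Dirichlet character χ mod m trivial on H has
L(E,χ,1) ≠ 0 (entire continuation of Σ χ(n)aₙ(E)n⁻ˢ non-zero at 1) then rank_ℤ E(F) = rank_ℤ E(ℚ)
(`(W.baseChange F).mordellWeilRank = W.mordellWeilRank`). Chain: (≥) E(ℚ) ↪ E(F)
(`Point.map_injective`; E(F) finitely generated, `module_finite_point_holds`; cf.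
`mordellWeilRank_baseChange_le_of_algHom` in Barriers/…C3C3Proofs); (≤) E(F) ⊗ ℚ splits into
isotypic parts over the ℚ-rational characters of G = Gal(F/ℚ); for χ ≠ 1, Kato, Astérisque 295
(2004) Cor. 14.3 (2) (E modular ⇒ quotient of J₁(N); K = F ⊂ ℚ(ζ_m) finite abelian; Kato's
L_S(f,χ,1), S = prime(cond F), differs from the mod-m series only by Euler polynomials non-vanishing
at 1) makes E(F)^{(χ)} = {x : I_χ·x = 0} finite, hence the χ-eigenspace of E(F) ⊗ ℂ is 0; the
trivial part is E(F)^G ⊗ ℚ = E(ℚ) ⊗ ℚ by Galois descent. Degree-1 case trivial (F ≅ ℚ). The printed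
input is the vendored named fact `Literature.NumberTheory.EllipticCurves.kato_fini -/
@[route_item "route-BirchSwinnertonDyer-PlecticLegs", crux]
def KatoDescent : Prop :=
  ∀ (W : WeierstrassCurve ℚ) [W.IsElliptic] (m : ℕ) [NeZero m] (H : Subgroup (CyclotomicField m ℚ ≃ₐ[ℚ] CyclotomicField m ℚ)), (∀ χ : DirichletCharacter ℂ m, (∀ σ ∈ H, ∀ a : ℕ, (∀ z : CyclotomicField m ℚ, z ^ m = 1 → σ z = z ^ a) → χ (a : ZMod m) = 1) → χ ≠ 1 → ∃ L : ℂ → ℂ, Differentiable ℂ L ∧ (∀ s : ℂ, 2 < s.re → L s = LSeries (fun n ↦ χ n * ((W.LFunction n : ℤ) : ℂ)) s) ∧ L 1 ≠ 0) → (W.baseChange ↥(IntermediateField.fixedField H)).mordellWeilRank = W.mordellWeilRank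

-- earlier Assembly (stmt-BirchSwinnertonDyer-17526, replaced 2026-08-17T02:24:37Z -> stmt-BirchSwinnertonDyer-18263): retired by None — PlecticPointsLB → PlecticRankUB → TwistSupply → Modularity → KatoChiFinite → ArtinBaseChange → RankDescent → RankLeOne → _root_.BirchSwinnertonDyer
/-- item stmt-BirchSwinnertonDyer-18263 · assembly · rank 1 · closed · proved by Summit.BirchSwinnertonDyer.BirchSwinnertonDyer.Theorems.plecticLegs_assembly_proof @ 4f5c9f5d33f2 (prover) · by planner
sources: Kato2004Asterisque, NekovarScholl2016
[assembly] PlecticPointsLB → PlecticRankUB → TwistSupply → ArtinBaseChange → KatoDescent → RankLeOne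
→ BirchSwinnertonDyer (literally the type of `closes`, rev 1). -/
@[route_item "route-BirchSwinnertonDyer-PlecticLegs"]
def Assembly : Prop :=
  PlecticPointsLB → PlecticRankUB → TwistSupply → ArtinBaseChange → KatoDescent → RankLeOne → _root_.BirchSwinnertonDyer

-- `Assembly` holds: proved by `Summit.BirchSwinnertonDyer.BirchSwinnertonDyer.Theorems.plecticLegs_assembly_proof` @ 4f5c9f5d33f2 (its module imports this route file, so no `_holds` link can be stated here).

-- records of items no longer active in this route (dropped / restated):
-- earlier RankDescent (stmt-BirchSwinnertonDyer-17524, replaced 2026-08-17T02:24:37Z -> stmt-BirchSwinnertonDyer-18262): retired by None — ∀ (W : WeierstrassCurve ℚ) [W.IsElliptic] (m : ℕ) [NeZero m] (H : Subgroup (CyclotomicField m ℚ ≃ₐ[ℚ] CyclotomicField m ℚ)), (∀ χ : DirichletCharacter ℂ m, (∀ σ ∈ H, Literature.NumberTheory.EllipticCurves.cyclotomicCharacterOf χ σ = 1) → χ ≠ 1 → Finite (Literatur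

/-! D-0027 §2.1 — DECIDING THEOREM (planner-authored via `route open/edit --closes-file`; by planner-rrepair-BirchSwinnertonDyer-PlecticLeg-8fe3cac2-0 2026-08-17T02:24:37Z):
its hypotheses are this route's items and its conclusion the sub-problem Statement (glue_lint), and it elaborates with this file. -/

@[closes "route-BirchSwinnertonDyer-PlecticLegs"] theorem closes (hLB : PlecticPointsLB) (hUB : PlecticRankUB) (hT : TwistSupply)
    (hA : ArtinBaseChange) (hK : KatoDescent) (hR1 : RankLeOne) :
    _root_.BirchSwinnertonDyer := by
  intro W hW
  haveI := hW
  by_cases h1 : W.analyticRank ≤ 1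
  · exact hR1 W h1
  · have h2 : 2 ≤ W.analyticRank := by omega
    obtain ⟨m, instm, H, hreal, hdeg, hchi⟩ := hT W h2
    haveI := instm
    letI : NumberField ↥(IntermediateField.fixedField H) := NumberField.mk
    haveI : NumberField.IsTotallyReal ↥(IntermediateField.fixedField H) := hreal
    haveI : (W.baseChange ↥(IntermediateField.fixedField H)).IsElliptic :=
      inferInstanceAs (W.map (algebraMap ℚ ↥(IntermediateField.fixedField H))).IsElliptic
    have hran : (W.baseChange ↥(IntermediateField.fixedField H)).analyticRank = W.analyticRank :=
      hA W m H hchi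
    have hdegF : 2 ≤ Module.finrank ℚ ↥(IntermediateField.fixedField H) := by omega
    have hranF : (W.baseChange ↥(IntermediateField.fixedField H)).analyticRank =
        Module.finrank ℚ ↥(IntermediateField.fixedField H) := by omega
    have hlb := hLB ↥(IntermediateField.fixedField H) (W.baseChange _) hdegF hranF
    have hub := hUB ↥(IntermediateField.fixedField H) (W.baseChange _) hdegF hranF
    have hdesc := hK W m H hchi
    omega

end Summit.BirchSwinnertonDyer.BirchSwinnertonDyer.Theses.PlecticLegs
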